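/-
Copyright (c) 2026 the pub-hodgecm-mathlib formalisation cell (harness21).  Prover seat hodgecm-mathlib-K2E4-p09 (g2), Track B «K2-LIT» ∕ h413
(`stmt-HodgeConjecture-24833`), line `K2_E3_EllipticInputs`, unit U3b, ROAD J of ‹S_loc›, leaf (J3r) «rank-one mass at a ramified odd place», road R3 (r), LETTER (E-ram):
THE EP DATUM OF `U(Φ₂)_v` AT A RAMIFIED ODD PLACE WITH ITS CONSTANT `r · ν₂(K₂) = (q − 1)∕(q + 1)`.  2026-09-04.
-/
import Literature.NumberTheory.Rogawski1990.RankOneEulerPoincareNonsplitCentralValue               -- ★ J2♯ p855726∕p855689: the ramified leaf (`scalar_mem_vertexEdgeLevels`, levels `K♯_D`) + ROAD W fold (`rhoVertexActPlace`, (E)∕(N) feeders)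
import Literature.NumberTheory.Automorphic.UnitaryTwoVertexEdgeStabilizerMassRatioRamifiedOdd     -- ★ LH4-p05 F7: `index_inf_…_of_sharp_of_uniformizer` (`[K♯:I] = q+1`, `[K⁰:I] = 2`), `forall_v_sharp_iff_coe_mem_map_conj`
import Literature.NumberTheory.LocalFields.RamifiedPlaceUnitNorms                                 -- ★ (U4) `valued_lt_one_of_galAdicCompletionMap_eq_neg_of_ramified_complexConj` (no anti-fixed unit at a tame place)
import Literature.NumberTheory.Weil1982.UnitaryFinTopFormRankOneSanitySplit                       -- ★ `valued_two_eq_one_of_not_mem` (`2 ∉ v ⇒ |2|_w = 1`)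
import Literature.NumberTheory.Rogawski1990.LocalTransferIdentityCoreThreeWaySplit                -- ★ `ramificationIdx'_ne_one_of_not_isUnramifiedIn_of_subsingleton`
import Summits.HodgeConjecture.HodgeConjecture.Theorems.K2E3EPConstantIndexFormUnramified         -- ★ F5 (this seat): `inv_add_inv_sub_inv_eq_neg`; brings ★ R2 `toReal_measure_coe_eq_relIndex_mul`
import HarnessLib

/-!
# K2_E3 road (h413), U3b ROAD J, leaf (J3r), road R3 (r) — LETTER (E-ram): KOTTWITZ'S EP DATUM OF `U(Φ₂)_v` AT A RAMIFIED ODD PLACE, `r · ν₂(K₂) = (q_v − 1)∕(q_v + 1)`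
# (Kottwitz 1988 §2; Rogawski 1990 §8.1, §12.6; Serre, Trees II.1.3; Tits 1979 §3.9)

Cell `pub/hodgecm-mathlib` (D-0151), Track B, squad K2; DEAL (D23) K2E3-plan (g2) 02:16Z «(E-ram) EP DATUM AT A RAMIFIED ODD PLACE» = S1 of the (r) assembly
`Theorems/K2E3CompatibleMeasureEPIdentityRankOneRamified.lean` (owner K2E3-p17 (g4)) of the leaf (J3r) `U3bCentralGerms.sig_K2E3CompatibleMeasureEPIdentityRankOneRamifiedOdd`
(PART B ED. 8 :420).  The (r) twin of ★ LETTER E `K2E3EPIndicesUnramified.exists_epDatum_of_unramified` in the SAME output shape: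
`∃ f₂ r, IsLocSmooth f₂ ∧ ‹orbital integrals 1 ∕ 0 on the regular elliptic ∕ split classes› ∧ ‹f₂(b·1) = −r› ∧ r · (ν₂ ↑K₂).toReal = (q − 1)∕(q + 1)`, `K₂ = U(Φ₂)(𝒪_v)`,
`q = |𝓞_{L⁺}∕v|`, under `¬ Algebra.IsUnramifiedIn (𝓞 L) v` and `2 ∉ v`.

THE MATHEMATICS.  At a place `v` of `L⁺` ramified in `L` (`w ∣ v`, `w̄ = w`) with `2 ∉ v` the anti-fixed element `α` of ★ `exists_units_galAdicCompletionMap_complexConj_eq_neg_of_ramified`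
is a UNIFORMISER of `L_w` (★ (U4): no anti-fixed units when `|2|_w = 1`), so `U(Φ₂)_v` acts on the tree of `SL₂(L⁺_v)` with `K⁰ = U(Φ₂)(𝒪_v)` fixing an EDGE and
`K♯ = e_w⁻¹(D_α GL₂(𝒪_w) D_α⁻¹)`, `D_α = diag(1, α)`, fixing one of its end vertices (ROAD W ★ `rhoVertexActPlace`, √π-type keying).  Kottwitz's relations (E), (N) at the
levels `(K♯, K⁰, K♯ ⊓ K⁰)` are read off that action exactly as in ★ `rankOneEulerPoincareNonsplit_withCentralValue` (★ `epEllipticRelation_vertexEdgeLevels_of_vertexAction_local`,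
★ `epNonEllipticRelation_vertexEdgeLevels_of_vertexAction_local`); the glue WITH VALUE (★ `exists_isLocSmooth_classOrbitalIntegral_eq_one_zero_and_apply_of_relations`) gives the
EP function `f` with `f(z) = ν(K♯)⁻¹ + ν(K⁰)⁻¹ − ν(I)⁻¹` at every central unit scalar (★ `scalar_mem_vertexEdgeLevels`).  The two indices are ★ LH4-p05's F7:
`[K♯ : I] = q + 1`, `[K⁰ : I] = 2` (★ `index_inf_cmLocalIntegralLevel_subgroupOf_eq_of_sharp_of_uniformizer`, ★ `index_inf_subgroupOf_cmLocalIntegralLevel_eq_two_of_sharp_of_uniformizer`,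
the `P♯`-currency bridged by ★ `forall_v_sharp_iff_coe_mem_map_conj` ∘ ★ `mem_comap_map_conj_glInt_iff`), whence with `r := ν(I)⁻¹ − ν(K♯)⁻¹ − ν(K⁰)⁻¹`:
`r · ν(K⁰) = 2 − 2∕(q+1) − 1 = (q − 1)∕(q + 1)` (and `r · ν(I) = (q − 1)∕(2(q + 1))`).

* §1 `valued_eq_exp_neg_one_of_antifixed` — at a ramified place with `2 ∉ v` an anti-fixed unit-or-uniformiser is a uniformiser.
* §2 `relIndex_sharp_inf_level_eq_of_antifixed_uniformizer` (`[K♯ : I] = q + 1 ∧ [K⁰ : I] = 2` for J2♯'s levels at `D_α`).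
* §3 **`exists_epDatum_of_ramified`** — LETTER (E-ram), binders `(w) (hw) (hv : ¬ Algebra.IsUnramifiedIn (𝓞 L) v.asIdeal) (h2 : (2 : 𝓞 L⁺) ∉ v.asIdeal) {m} (hm)`.

THEOREMS ONLY; lane `--supports stmt-HodgeConjecture-24833 --as helper`.  HONEST LABEL: HC_CM is proved only modulo the 7 printed citations (2 remaining named inputs:
hLiu418 = stmt-HodgeConjecture-24832, h413 = stmt-HodgeConjecture-24833) until rung 0 closes; count-neutral helper; (J3r) is NOT proved by this file (S1 only).

## References
* [Kottwitz1988] R. E. Kottwitz, *Tamagawa numbers*, Ann. of Math. 127 (1988) 629–646, §2 Theorem 2 (the Euler–Poincaré function, `[K_σ : I]`).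
* [Rogawski1990] J. D. Rogawski, *Automorphic Representations of Unitary Groups in Three Variables*, Ann. of Math. Stud. 123 (1990), §8.1 p. 117; §12.6 p. 174.
* [Serre1980Trees] J.-P. Serre, *Trees* (1980), Ch. II §1.3 (the tree of `SL₂` over a local field: vertex and edge stabilisers).
* [Tits1979] J. Tits, *Reductive groups over local fields*, PSPM 33.1 (1979), §2.7, §3.9 (ramified quasi-split `U(1,1)`: local indices `2`, `q+1`).
* [Serre1979] J.-P. Serre, *Local Fields*, GTM 67 (1979), Ch. V §3 (tamely ramified quadratic extensions: no anti-fixed units).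
-/

set_option autoImplicit false
set_option linter.dupNamespace false  -- the mandated namespace repeats the summit's segment, as in every `Theorems/*.lean` here

noncomputable section

open scoped ValuativeRel Matrix MatrixGroups ENNReal NNReal
open Matrix ValuativeRel NumberField IsDedekindDomain MeasureTheory Measure

namespace Summit.HodgeConjecture.HodgeConjecture.Cruxes.H413.K2E3EPIndicesRamified

open Literature.NumberTheory.Rogawski1990 Literature.MeasureTheory.Group
open Literature.NumberTheory.Automorphic Literature.NumberTheory.Automorphic.UnitaryGroup Literature.NumberTheory.Automorphic.HermitianLatticeTree
  Literature.NumberTheory.GaloisRepresentations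
open Literature.NumberTheory.Weil1982.UnitaryFinTopForm (valued_two_eq_one_of_not_mem)
open Literature.NumberTheory.LocalFields.RamifiedPlaceUnitNorms (valued_lt_one_of_galAdicCompletionMap_eq_neg_of_ramified_complexConj)
open Summit.HodgeConjecture.HodgeConjecture.Cruxes.H413.K2E3EPValueIndexForm Summit.HodgeConjecture.HodgeConjecture.Cruxes.H413.K2E3EPConstantIndexFormUnramified

section Indices

variable (L : Type) [Field L] [NumberField L] [IsCMField L] {v : HeightOneSpectrum (𝓞 ↥(maximalRealSubfield L))}
  (w : PlacesOver L v) (hw : IsCMField.complexConj L • w.1 = w.1)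

/-! ## §1 At a ramified place with `2 ∉ v` the anti-fixed element is a uniformiser -/

include hw in
/-- **An anti-fixed unit-or-uniformiser is a uniformiser when `2 ∉ v`**: ★ (U4) forbids anti-fixed units at a place where `|2|_w = 1`. [cite: Serre1979, Ch. V §3] -/
theorem valued_eq_exp_neg_one_of_antifixed (he : v.asIdeal.ramificationIdx' w.1.asIdeal ≠ 1) (h2 : (2 : 𝓞 ↥(maximalRealSubfield L)) ∉ v.asIdeal)
    {α : w.1.adicCompletion L} (hα : galAdicCompletionMap (L := L) (IsCMField.complexConj L) hw α = -α)
    (hvα : Valued.v α = 1 ∨ Valued.v α = WithZero.exp (-1 : ℤ)) : Valued.v α = WithZero.exp (-1 : ℤ) := by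
  rcases hvα with h1 | h1
  · exact absurd h1 (valued_lt_one_of_galAdicCompletionMap_eq_neg_of_ramified_complexConj L w hw he (valued_two_eq_one_of_not_mem L v w h2) h1.le hα).ne
  · exact h1

/-! ## §2 The two EP indices of J2♯'s ramified levels `K♯ = e_w⁻¹(D_α GL₂(𝒪_w) D_α⁻¹)`, `K⁰ = U(Φ₂)(𝒪_v)` -/

include hw in
/-- **`[K♯ : K♯ ⊓ K⁰] = q_v + 1` and `[K⁰ : K♯ ⊓ K⁰] = 2`** at a ramified place (`e(w|v) ≠ 1`) for an anti-fixed uniformiser `α` of `L_w` and J2♯'s levels `K♯ = e_w⁻¹(D_α GL₂(𝒪_w) D_α⁻¹)`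
(★ `mem_comap_map_conj_glInt_iff`), `K⁰ = U(Φ₂)(𝒪_v)`: ★ LH4-p05 F7 in the `P♯` currency (★ `forall_v_sharp_iff_coe_mem_map_conj`), `q_v = |𝓞_{L⁺}∕v|` (Mathlib `Ideal.absNorm_apply`).
[cite: Tits1979, §3.9] [cite: Serre1980Trees, Ch. II §1.3] [cite: Kottwitz1988, §2] -/
theorem relIndex_sharp_inf_level_eq_of_antifixed_uniformizer (he : v.asIdeal.ramificationIdx' w.1.asIdeal ≠ 1)
    (α : (w.1.adicCompletion L)ˣ) (hα : galAdicCompletionMap (L := L) (IsCMField.complexConj L) hw (α : w.1.adicCompletion L) = -(α : w.1.adicCompletion L))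
    (hvα : Valued.v (α : w.1.adicCompletion L) = WithZero.exp (-1 : ℤ)) :
    ((((glInt 2 (w.1.adicCompletion L)).map (MulAut.conj (glDiagonal 2 (w.1.adicCompletion L) ![1, α])).toMonoidHom).comap
          (((unitaryGroupOfForm (galAdicCompletionMap (L := L) (IsCMField.complexConj L) hw) (placeForm (Matrix.of fun i j : Fin 2 => if i.val + j.val + 1 = 2 then (1 : L) else 0) w.1)).subtype.comp
            (localNonsplitEquiv (IsCMField.complexConj L) (Matrix.of fun i j : Fin 2 => if i.val + j.val + 1 = 2 then (1 : L) else 0)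
          (IsCMField.complexConj_ne_one L) w hw).toMonoidHom :
            (cmDatum L 2 (Matrix.of fun i j : Fin 2 => if i.val + j.val + 1 = 2 then (1 : L) else 0)).Local v →* GL (Fin 2) (w.1.adicCompletion L)))) ⊓
        cmLocalIntegralLevel L 2 (Matrix.of fun i j : Fin 2 => if i.val + j.val + 1 = 2 then (1 : L) else 0) v).relIndex
      ((((glInt 2 (w.1.adicCompletion L)).map (MulAut.conj (glDiagonal 2 (w.1.adicCompletion L) ![1, α])).toMonoidHom).comap
          (((unitaryGroupOfForm (galAdicCompletionMap (L := L) (IsCMField.complexConj L) hw) (placeForm (Matrix.of fun i j : Fin 2 => if i.val + j.val + 1 = 2 then (1 : L) else 0) w.1)).subtype.comp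
            (localNonsplitEquiv (IsCMField.complexConj L) (Matrix.of fun i j : Fin 2 => if i.val + j.val + 1 = 2 then (1 : L) else 0)
          (IsCMField.complexConj_ne_one L) w hw).toMonoidHom :
            (cmDatum L 2 (Matrix.of fun i j : Fin 2 => if i.val + j.val + 1 = 2 then (1 : L) else 0)).Local v →* GL (Fin 2) (w.1.adicCompletion L))))) =
        Nat.card (𝓞 ↥(maximalRealSubfield L) ⧸ v.asIdeal) + 1 ∧
    ((((glInt 2 (w.1.adicCompletion L)).map (MulAut.conj (glDiagonal 2 (w.1.adicCompletion L) ![1, α])).toMonoidHom).comap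
          (((unitaryGroupOfForm (galAdicCompletionMap (L := L) (IsCMField.complexConj L) hw) (placeForm (Matrix.of fun i j : Fin 2 => if i.val + j.val + 1 = 2 then (1 : L) else 0) w.1)).subtype.comp
            (localNonsplitEquiv (IsCMField.complexConj L) (Matrix.of fun i j : Fin 2 => if i.val + j.val + 1 = 2 then (1 : L) else 0)
          (IsCMField.complexConj_ne_one L) w hw).toMonoidHom :
            (cmDatum L 2 (Matrix.of fun i j : Fin 2 => if i.val + j.val + 1 = 2 then (1 : L) else 0)).Local v →* GL (Fin 2) (w.1.adicCompletion L)))) ⊓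
        cmLocalIntegralLevel L 2 (Matrix.of fun i j : Fin 2 => if i.val + j.val + 1 = 2 then (1 : L) else 0) v).relIndex
      (cmLocalIntegralLevel L 2 (Matrix.of fun i j : Fin 2 => if i.val + j.val + 1 = 2 then (1 : L) else 0) v) = 2 := by
  classical
  -- J2♯'s `K♯` in the `P♯` currency of ★ F7
  have hKs : ∀ g : ↥(unitaryGroupOfForm (conjLocal L (IsCMField.complexConj L) v) (cmLocalForm L 2 v)),
      g ∈ (((glInt 2 (w.1.adicCompletion L)).map (MulAut.conj (glDiagonal 2 (w.1.adicCompletion L) ![1, α])).toMonoidHom).comap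
          (((unitaryGroupOfForm (galAdicCompletionMap (L := L) (IsCMField.complexConj L) hw) (placeForm (Matrix.of fun i j : Fin 2 => if i.val + j.val + 1 = 2 then (1 : L) else 0) w.1)).subtype.comp
            (localNonsplitEquiv (IsCMField.complexConj L) (Matrix.of fun i j : Fin 2 => if i.val + j.val + 1 = 2 then (1 : L) else 0)
          (IsCMField.complexConj_ne_one L) w hw).toMonoidHom :
            (cmDatum L 2 (Matrix.of fun i j : Fin 2 => if i.val + j.val + 1 = 2 then (1 : L) else 0)).Local v →* GL (Fin 2) (w.1.adicCompletion L)))) ↔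
        (∀ a b : Fin 2, Valued.v ((α : (w.1.adicCompletion L)) ^ (b : ℕ) * ((α : (w.1.adicCompletion L)) ^ (a : ℕ))⁻¹ * ((((localNonsplitEquiv (IsCMField.complexConj L) (Matrix.of fun i j : Fin 2 => if i.val + j.val + 1 = 2 then (1 : L) else 0) (IsCMField.complexConj_ne_one L) w hw) g : ↥(unitaryGroupOfForm (galAdicCompletionMap (L := L) (IsCMField.complexConj L) hw) (placeForm (Matrix.of fun i j : Fin 2 => if i.val + j.val + 1 = 2 then (1 : L) else 0) w.1))) : GL (Fin 2) (w.1.adicCompletion L)) : Matrix (Fin 2) (Fin 2) (w.1.adicCompletion L)) a b) ≤ 1) := fun g =>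
    (mem_comap_map_conj_glInt_iff L w hw (glDiagonal 2 (w.1.adicCompletion L) ![1, α]) g).trans
      (forall_v_sharp_iff_coe_mem_map_conj L w hw α ((localNonsplitEquiv (IsCMField.complexConj L) (Matrix.of fun i j : Fin 2 => if i.val + j.val + 1 = 2 then (1 : L) else 0)
        (IsCMField.complexConj_ne_one L) w hw) g)).symm
  obtain ⟨K, hK⟩ := exists_subgroup_forall_mem_iff_flat L v w hw (α : (w.1.adicCompletion L)) hvα
  have hq : Ideal.absNorm v.asIdeal = Nat.card (𝓞 ↥(maximalRealSubfield L) ⧸ v.asIdeal) := by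
    rw [Ideal.absNorm_apply, Submodule.cardQuot_apply]
  refine ⟨?_, ?_⟩
  · rw [← hq]
    exact index_inf_cmLocalIntegralLevel_subgroupOf_eq_of_sharp_of_uniformizer L v w hw he hvα hα (α : (w.1.adicCompletion L)) hvα hα K hK _ hKs
  · exact index_inf_subgroupOf_cmLocalIntegralLevel_eq_two_of_sharp_of_uniformizer L v w hw he hvα hα (α : (w.1.adicCompletion L)) hvα K hK _ hKs

end Indices

/-! ## §3 LETTER (E-ram): the EP datum with `r · ν(K⁰) = (q_v − 1)∕(q_v + 1)` -/

section Letter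

variable (L : Type) [Field L] [NumberField L] [IsCMField L] {v : HeightOneSpectrum (𝓞 ↥(maximalRealSubfield L))}
  [MeasurableSpace ((cmDatum L 2 (Matrix.of fun i j : Fin 2 => if i.val + j.val + 1 = 2 then (1 : L) else 0)).Local v)]
  [BorelSpace ((cmDatum L 2 (Matrix.of fun i j : Fin 2 => if i.val + j.val + 1 = 2 then (1 : L) else 0)).Local v)]
  [∀ γ : (cmDatum L 2 (Matrix.of fun i j : Fin 2 => if i.val + j.val + 1 = 2 then (1 : L) else 0)).Local v,
    MeasurableSpace (((cmDatum L 2 (Matrix.of fun i j : Fin 2 => if i.val + j.val + 1 = 2 then (1 : L) else 0)).Local v) ⧸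
      Subgroup.centralizer ({γ} : Set ((cmDatum L 2 (Matrix.of fun i j : Fin 2 => if i.val + j.val + 1 = 2 then (1 : L) else 0)).Local v)))]
  [∀ γ : (cmDatum L 2 (Matrix.of fun i j : Fin 2 => if i.val + j.val + 1 = 2 then (1 : L) else 0)).Local v,
    BorelSpace (((cmDatum L 2 (Matrix.of fun i j : Fin 2 => if i.val + j.val + 1 = 2 then (1 : L) else 0)).Local v) ⧸
      Subgroup.centralizer ({γ} : Set ((cmDatum L 2 (Matrix.of fun i j : Fin 2 => if i.val + j.val + 1 = 2 then (1 : L) else 0)).Local v)))]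
  (ν : Measure ((cmDatum L 2 (Matrix.of fun i j : Fin 2 => if i.val + j.val + 1 = 2 then (1 : L) else 0)).Local v))
  [IsHaarMeasure ν] [ν.IsMulRightInvariant]

set_option maxHeartbeats 800000 in  -- HB: the ROAD W tree-action binders are transported along `localNonsplitEquiv` (definitional `cmDatum.Local` unfoldings), as in ★ J2♯'s assembly
/-- **LETTER (E-ram) OF THE (r)-ASSEMBLY (leaf (J3r), S1; road R3 (r) owner K2E3-p17 (g4)).**  For `v` RAMIFIED and non-split in `L` (`w ∣ v`, `w̄ = w`) with `2 ∉ v`, any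
two-sided Haar measure `ν₂` and canonical orbital measures `m₂` on `U(Φ₂)_v`, there are `f₂ ∈ C_c^∞(U(Φ₂)_v)` (Kottwitz's EP function of the edge `K⁰ = U(Φ₂)(𝒪_v)` and its
end vertex `K♯`) and `r : ℝ` with orbital integrals `1 ∕ 0` on the regular elliptic ∕ split classes, `f₂(b·1) = −r` at the central unit scalars, and
**`r · ν₂(↑K₂).toReal = (q_v − 1)∕(q_v + 1)`**, `K₂ = U(Φ₂)(𝒪_v)`, `q_v = |𝓞_{L⁺} ∕ v|` (`[K♯ : I] = q_v + 1`, `[K⁰ : I] = 2`: `r · ν₂(I) = 1 − 1∕(q_v+1) − 1∕2`). Same output shape as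
★ LETTER E `exists_epDatum_of_unramified`. [cite: Kottwitz1988, §2 Theorem 2] [cite: Rogawski1990, §8.1 p. 117; §12.6 p. 174] [cite: Serre1980Trees, Ch. II §1.3] [cite: Tits1979, §3.9] -/
theorem exists_epDatum_of_ramified (w : PlacesOver L v) (hw : IsCMField.complexConj L • w.1 = w.1)
    (hv : ¬ Algebra.IsUnramifiedIn (𝓞 L) v.asIdeal) (h2 : (2 : 𝓞 ↥(maximalRealSubfield L)) ∉ v.asIdeal)
    {m : OrbitalMeasureFamily ((cmDatum L 2 (Matrix.of fun i j : Fin 2 => if i.val + j.val + 1 = 2 then (1 : L) else 0)).Local v)}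
    (hm : m.IsCanonical (fun γ => IsRegularElt (γ.val : GL (Fin 2) (UnitaryGroup.LocalRing L v))) ν) :
    ∃ (f₂ : ((cmDatum L 2 (Matrix.of fun i j : Fin 2 => if i.val + j.val + 1 = 2 then (1 : L) else 0)).Local v) → ℂ) (r : ℝ), IsLocSmooth f₂ ∧
      (∀ γ : (cmDatum L 2 (Matrix.of fun i j : Fin 2 => if i.val + j.val + 1 = 2 then (1 : L) else 0)).Local v,
          IsRegularElt (γ.val : GL (Fin 2) (UnitaryGroup.LocalRing L v)) →
          CompactSpace (Subgroup.centralizer ({γ} : Set ((cmDatum L 2 (Matrix.of fun i j : Fin 2 => if i.val + j.val + 1 = 2 then (1 : L) else 0)).Local v))) →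
          classOrbitalIntegral m f₂ (ConjClasses.mk γ) = 1) ∧
      (∀ γ : (cmDatum L 2 (Matrix.of fun i j : Fin 2 => if i.val + j.val + 1 = 2 then (1 : L) else 0)).Local v,
          IsRegularElt (γ.val : GL (Fin 2) (UnitaryGroup.LocalRing L v)) →
          ¬ CompactSpace (Subgroup.centralizer ({γ} : Set ((cmDatum L 2 (Matrix.of fun i j : Fin 2 => if i.val + j.val + 1 = 2 then (1 : L) else 0)).Local v))) →
          classOrbitalIntegral m f₂ (ConjClasses.mk γ) = 0) ∧
      (∀ (z : (cmDatum L 2 (Matrix.of fun i j : Fin 2 => if i.val + j.val + 1 = 2 then (1 : L) else 0)).Local v) (b : LocalRing L v),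
          ((z.val : GL (Fin 2) (LocalRing L v)).val : Matrix (Fin 2) (Fin 2) (LocalRing L v)) = b • (1 : Matrix (Fin 2) (Fin 2) (LocalRing L v)) →
          f₂ z = -(r : ℂ)) ∧
      r * (ν (cmLocalIntegralLevel L 2 (Matrix.of fun i j : Fin 2 => if i.val + j.val + 1 = 2 then (1 : L) else 0) v :
          Set ((cmDatum L 2 (Matrix.of fun i j : Fin 2 => if i.val + j.val + 1 = 2 then (1 : L) else 0)).Local v))).toReal =
        ((Nat.card (𝓞 ↥(maximalRealSubfield L) ⧸ v.asIdeal) : ℝ) - 1) / ((Nat.card (𝓞 ↥(maximalRealSubfield L) ⧸ v.asIdeal) : ℝ) + 1) := by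
  classical
  have hc1 : IsCMField.complexConj L ≠ 1 := IsCMField.complexConj_ne_one L
  haveI hsub : Subsingleton (PlacesOver L v) := PlacesOver.subsingleton_of_smul_eq (IsCMField.complexConj L) hc1 w hw
  have he : v.asIdeal.ramificationIdx' w.1.asIdeal ≠ 1 := ramificationIdx'_ne_one_of_not_isUnramifiedIn_of_subsingleton L hsub w hv
  -- the anti-fixed UNIFORMISER `α` (tame: no anti-fixed unit)
  obtain ⟨α, hα, hvα'⟩ := exists_units_galAdicCompletionMap_complexConj_eq_neg_of_ramified L w hw he
  have hvα : Valued.v (α : w.1.adicCompletion L) = WithZero.exp (-1 : ℤ) := valued_eq_exp_neg_one_of_antifixed L w hw he h2 hα hvα'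
  have hα0 : (α : w.1.adicCompletion L) ≠ 0 := α.ne_zero
  -- ROAD W: the tree of `SL₂(L⁺_v)` with `U(Φ₂)_v` acting through `rhoVertexActPlace`, keyed by `α` (√π-type): `K♯_{D_α}`-vertex `v₁`, `K⁰`-edge `{v₁, v₀}`
  obtain ⟨ϖF, hϖF⟩ : ∃ ϖF : v.adicCompletion ↥(maximalRealSubfield L), Valued.v ϖF = WithZero.exp (-1 : ℤ) :=
    ⟨_, HeckeCharacter.valued_uniformizer (K := ↥(maximalRealSubfield L)) (v := v)⟩
  haveI : IsDiscreteValuationRing 𝒪[v.adicCompletion ↥(maximalRealSubfield L)] := isDiscreteValuationRing_integer_of_compatible hϖF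
  have hϖ : IsUniformizingElement ϖF := isUniformizingElement_of_v_eq hϖF
  obtain ⟨g₁, hg₁, hdet₁⟩ := exists_coe_eq_diagonal_one_uniformizer (F := v.adicCompletion ↥(maximalRealSubfield L)) hϖ.ne_zero
  obtain ⟨v₀, v₁, hv₀, hv₁⟩ : ∃ v₀ v₁ : {M : Submodule 𝒪[v.adicCompletion ↥(maximalRealSubfield L)] (Fin 2 → v.adicCompletion ↥(maximalRealSubfield L)) //
      IsSpecialLattice (RingHom.id _) ϖF !![(0 : v.adicCompletion ↥(maximalRealSubfield L)), 1; -1, 0] M},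
      v₀.1 = latt (1 : Matrix (Fin 2) (Fin 2) (v.adicCompletion ↥(maximalRealSubfield L))) ∧
        v₁.1 = latt (Matrix.diagonal ![(1 : v.adicCompletion ↥(maximalRealSubfield L)), ϖF]) :=
    ⟨⟨latt (1 : Matrix (Fin 2) (Fin 2) (v.adicCompletion ↥(maximalRealSubfield L))),
        Or.inl ((isSelfDualLattice_id_altJ_iff _).2 ⟨1, by rw [Units.val_one], by rw [Units.val_one, det_one, map_one]⟩)⟩,
      ⟨latt (Matrix.diagonal ![(1 : v.adicCompletion ↥(maximalRealSubfield L)), ϖF]),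
        Or.inr ((isModularLattice_id_altJ_iff hϖ.ne_zero _).2 ⟨g₁, by rw [hg₁], by rw [hdet₁]⟩)⟩, rfl, rfl⟩
  have hX := isTree_latticeTree_id_altJ hϖ
  have h01 := latticeTree_adj_root hϖ v₀ v₁ hv₀ hv₁
  have hE := fun (γ : (cmDatum L 2 (Matrix.of fun i j : Fin 2 => if i.val + j.val + 1 = 2 then (1 : L) else 0)).Local v)
      (hreg : IsRegularElt (γ.val : GL (Fin 2) (UnitaryGroup.LocalRing L v)))
      (hc : CompactSpace (Subgroup.centralizer ({γ} : Set ((cmDatum L 2 (Matrix.of fun i j : Fin 2 => if i.val + j.val + 1 = 2 then (1 : L) else 0)).Local v)))) =>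
    epEllipticRelation_vertexEdgeLevels_of_vertexAction_local L w hw (glDiagonal 2 (w.1.adicCompletion L) ![1, α]) hX
      (rhoVertexActPlace L v w hw hα hα0 hϖF) (rhoVertexActPlace_one L v w hw hα hα0 hϖF) (rhoVertexActPlace_mul L v w hw hα hα0 hϖF)
      (latticeTree_adj_rhoVertexActPlace_iff L v w hw hα hα0 hϖF) h01.symm (exists_rhoVertexActPlace_eq' L v w hw hα hα0 hϖF he v₁)
      (fun _ _ hab => exists_rhoVertexActPlace_eq_of_adj' L v w hw hα hα0 hϖF he v₁ v₀ hv₁ hv₀ hab)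
      (forall_coe_mem_map_conj_glDiagonal_iff_rhoVertexActPlace_next_eq L v w hw hα hα0 hϖF v₁ hv₁ he hvα α hvα)
      (forall_coe_mem_glInt_iff_sym2_rhoVertexActPlace_eq L v w hw hα hα0 hϖF v₀ v₁ hv₀ hv₁ he hvα) γ hreg hc
  have hN := fun (γ : (cmDatum L 2 (Matrix.of fun i j : Fin 2 => if i.val + j.val + 1 = 2 then (1 : L) else 0)).Local v)
      (hreg : IsRegularElt (γ.val : GL (Fin 2) (UnitaryGroup.LocalRing L v)))
      (hnc : ¬ CompactSpace (Subgroup.centralizer ({γ} : Set ((cmDatum L 2 (Matrix.of fun i j : Fin 2 => if i.val + j.val + 1 = 2 then (1 : L) else 0)).Local v)))) =>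
    epNonEllipticRelation_vertexEdgeLevels_of_vertexAction_local L w hw α hvα ν ![1, α] hm hX
      (rhoVertexActPlace L v w hw hα hα0 hϖF) (rhoVertexActPlace_one L v w hw hα hα0 hϖF) (rhoVertexActPlace_mul L v w hw hα hα0 hϖF)
      (latticeTree_adj_rhoVertexActPlace_iff L v w hw hα hα0 hϖF) h01.symm (exists_rhoVertexActPlace_eq' L v w hw hα hα0 hϖF he v₁)
      (fun _ _ hab => exists_rhoVertexActPlace_eq_of_adj' L v w hw hα hα0 hϖF he v₁ v₀ hv₁ hv₀ hab)
      (forall_coe_mem_map_conj_glDiagonal_iff_rhoVertexActPlace_next_eq L v w hw hα hα0 hϖF v₁ hv₁ he hvα α hvα)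
      (forall_coe_mem_glInt_iff_sym2_rhoVertexActPlace_eq L v w hw hα hα0 hϖF v₀ v₁ hv₀ hv₁ he hvα)
      (latticeTree_adj_root_rhoVertexActPlace_of_coe_eq_diagonal' L v w hw hα hα0 hϖF he α hvα v₁ hv₁) γ hreg hnc
  -- the levels are compact open; the glue WITH VALUE
  obtain ⟨hSc, hSo⟩ := isCompact_isOpen_comap_map_conj_glInt L w hw (glDiagonal 2 (w.1.adicCompletion L) ![1, α])
  obtain ⟨hKc, hKo⟩ := isCompact_isOpen_cmLocalIntegralLevel L 2 (Matrix.of fun i j : Fin 2 => if i.val + j.val + 1 = 2 then (1 : L) else 0) v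
  obtain ⟨hIc, hIo⟩ := isCompact_isOpen_comap_map_conj_glInt_inf_cmLocalIntegralLevel L w hw (glDiagonal 2 (w.1.adicCompletion L) ![1, α])
  obtain ⟨f, hf, h1, h0, hval⟩ := exists_isLocSmooth_classOrbitalIntegral_eq_one_zero_and_apply_of_relations L 2 _ v ν
    (UnitaryGroup.antidiagOne_isHermitian L 2) (UnitaryGroup.isUnit_antidiagOne_det L 2).ne_zero hm _ _ _ hSo hSc hKo hKc hIo hIc hE hN
  -- the two indices and the three masses
  obtain ⟨i1, i0⟩ := relIndex_sharp_inf_level_eq_of_antifixed_uniformizer L w hw he α hα hvα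
  have hmS := toReal_measure_coe_eq_relIndex_mul ν _ _ (inf_le_left : (((glInt 2 (w.1.adicCompletion L)).map (MulAut.conj (glDiagonal 2 (w.1.adicCompletion L) ![1, α])).toMonoidHom).comap
          (((unitaryGroupOfForm (galAdicCompletionMap (L := L) (IsCMField.complexConj L) hw) (placeForm (Matrix.of fun i j : Fin 2 => if i.val + j.val + 1 = 2 then (1 : L) else 0) w.1)).subtype.comp
            (localNonsplitEquiv (IsCMField.complexConj L) (Matrix.of fun i j : Fin 2 => if i.val + j.val + 1 = 2 then (1 : L) else 0)
          (IsCMField.complexConj_ne_one L) w hw).toMonoidHom :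
            (cmDatum L 2 (Matrix.of fun i j : Fin 2 => if i.val + j.val + 1 = 2 then (1 : L) else 0)).Local v →* GL (Fin 2) (w.1.adicCompletion L)))) ⊓
        cmLocalIntegralLevel L 2 (Matrix.of fun i j : Fin 2 => if i.val + j.val + 1 = 2 then (1 : L) else 0) v ≤ _) hSo hSc hIo
  have hmK := toReal_measure_coe_eq_relIndex_mul ν _ _ (inf_le_right : (((glInt 2 (w.1.adicCompletion L)).map (MulAut.conj (glDiagonal 2 (w.1.adicCompletion L) ![1, α])).toMonoidHom).comap
          (((unitaryGroupOfForm (galAdicCompletionMap (L := L) (IsCMField.complexConj L) hw) (placeForm (Matrix.of fun i j : Fin 2 => if i.val + j.val + 1 = 2 then (1 : L) else 0) w.1)).subtype.comp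
            (localNonsplitEquiv (IsCMField.complexConj L) (Matrix.of fun i j : Fin 2 => if i.val + j.val + 1 = 2 then (1 : L) else 0)
          (IsCMField.complexConj_ne_one L) w hw).toMonoidHom :
            (cmDatum L 2 (Matrix.of fun i j : Fin 2 => if i.val + j.val + 1 = 2 then (1 : L) else 0)).Local v →* GL (Fin 2) (w.1.adicCompletion L)))) ⊓
        cmLocalIntegralLevel L 2 (Matrix.of fun i j : Fin 2 => if i.val + j.val + 1 = 2 then (1 : L) else 0) v ≤ _) hKo hKc hIo
  rw [i1] at hmS
  rw [i0] at hmK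
  have hI0 := toReal_measure_pos_of_isOpen_isCompact ν _ hIo hIc
  set q : ℕ := Nat.card (𝓞 ↥(maximalRealSubfield L) ⧸ v.asIdeal) with hq
  have hq1 : (q : ℝ) + 1 ≠ 0 := by positivity
  -- the three masses as real numbers
  set a : ℝ := (ν ((((glInt 2 (w.1.adicCompletion L)).map (MulAut.conj (glDiagonal 2 (w.1.adicCompletion L) ![1, α])).toMonoidHom).comap
          (((unitaryGroupOfForm (galAdicCompletionMap (L := L) (IsCMField.complexConj L) hw) (placeForm (Matrix.of fun i j : Fin 2 => if i.val + j.val + 1 = 2 then (1 : L) else 0) w.1)).subtype.comp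
            (localNonsplitEquiv (IsCMField.complexConj L) (Matrix.of fun i j : Fin 2 => if i.val + j.val + 1 = 2 then (1 : L) else 0)
          (IsCMField.complexConj_ne_one L) w hw).toMonoidHom :
            (cmDatum L 2 (Matrix.of fun i j : Fin 2 => if i.val + j.val + 1 = 2 then (1 : L) else 0)).Local v →* GL (Fin 2) (w.1.adicCompletion L)))) : Set ((cmDatum L 2 (Matrix.of fun i j : Fin 2 => if i.val + j.val + 1 = 2 then (1 : L) else 0)).Local v))).toReal with ha
  set b : ℝ := (ν (cmLocalIntegralLevel L 2 (Matrix.of fun i j : Fin 2 => if i.val + j.val + 1 = 2 then (1 : L) else 0) v : Set ((cmDatum L 2 (Matrix.of fun i j : Fin 2 => if i.val + j.val + 1 = 2 then (1 : L) else 0)).Local v))).toReal with hb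
  set c : ℝ := (ν (↑((((glInt 2 (w.1.adicCompletion L)).map (MulAut.conj (glDiagonal 2 (w.1.adicCompletion L) ![1, α])).toMonoidHom).comap
          (((unitaryGroupOfForm (galAdicCompletionMap (L := L) (IsCMField.complexConj L) hw) (placeForm (Matrix.of fun i j : Fin 2 => if i.val + j.val + 1 = 2 then (1 : L) else 0) w.1)).subtype.comp
            (localNonsplitEquiv (IsCMField.complexConj L) (Matrix.of fun i j : Fin 2 => if i.val + j.val + 1 = 2 then (1 : L) else 0)
          (IsCMField.complexConj_ne_one L) w hw).toMonoidHom :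
            (cmDatum L 2 (Matrix.of fun i j : Fin 2 => if i.val + j.val + 1 = 2 then (1 : L) else 0)).Local v →* GL (Fin 2) (w.1.adicCompletion L)))) ⊓
        cmLocalIntegralLevel L 2 (Matrix.of fun i j : Fin 2 => if i.val + j.val + 1 = 2 then (1 : L) else 0) v) : Set ((cmDatum L 2 (Matrix.of fun i j : Fin 2 => if i.val + j.val + 1 = 2 then (1 : L) else 0)).Local v))).toReal with hc
  have hc0 : c ≠ 0 := hI0.ne'
  -- the datum
  refine ⟨f, c⁻¹ - a⁻¹ - b⁻¹, hf, h1, h0, fun z b' hz => ?_, ?_⟩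
  · obtain ⟨hzS, hzK, hzI⟩ := scalar_mem_vertexEdgeLevels L w hw (glDiagonal 2 (w.1.adicCompletion L) ![1, α]) z b' hz
    rw [hval z hzS hzK hzI]
    exact inv_add_inv_sub_inv_eq_neg a b c
  · rw [hmK, hmS]
    push_cast
    field_simp
    ring

end Letter

end Summit.HodgeConjecture.HodgeConjecture.Cruxes.H413.K2E3EPIndicesRamified

end
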